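import Summits.NavierStokesRegularity.NavierStokesRegularity.Theorems.ExtremiserTransienceSparseBangBangDefs
import HarnessLib

/-!
# Route `ExtremiserTransience`, crux `NearExtremalTransiencePerFlow` (stmt-NavierStokesRegularity-26567),
# LINE g8-β «analytic gap»: THE TEXTS OF RECORD of §0–§1 (vocabulary and the statements P-F / P-R / P-C / G / S-A)

Texts of record, VERBATIM §0–§1 of the published line `Cruxes/NearExtremalTransiencePerFlow/Lines/analytic_gap.lean`
(planner ns-idea-5 g8, rev 3; critic verdict PASS idea-crit-4 2026-08-28T21:45:37Z, rev 3 booked 22:04:54Z; a crux WORKFILE under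
KEY-NS #155, not the registered skeleton of record), so that the line's stubs can be stated BY NAME in `Theorems/` files:
* `IsAnalyticReg ρ v M`, `facBudget ρ` (+ the line's two one-line lemmas `isReg_of_isAnalyticReg`, `one_le_facBudget`, verbatim);
* `AnalyticPropagationOfSmallness` (P-F, the line's single Literature dependency, to be lifted verbatim by a typer),
  `AnalyticPlateauSpread` (P-R), `PlateauSobolevCost` (P-C — PROVED: `…AnalyticGap.plateauSobolevCost`, p672703),
  `SparseAnalyticGap` (G), `SparseAnalyticTransfer` (S-A; prover hand ns-net-p1).
`IsSparse`, `SparseEfficientTimes` are the landed g8-α texts of record `…Theorems.NearExtremalTransiencePerFlow.SparseBangBang.*`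
(file `ExtremiserTransienceSparseBangBangDefs`, byte-identical bodies), and `IsViolator` is `…ZoneTransversality.IsViolator`, exactly as
the line has them.  All bodies are the line's, so the line's stubs close by `exact` from theorems stated with these names.
Landed by prover seat `ns-net-p1` (g2). HONEST FRAMING: definitions only; nothing about Navier–Stokes regularity or blow-up is proved;
no summit is proved by a line.
-/

noncomputable section

open scoped Topology InnerProductSpace RealInnerProductSpace ENNReal ContDiff
open MeasureTheory Filter Set Metric
open Literature.Analysis.FluidPDE
open Summit.NavierStokesRegularity.NavierStokesRegularity.Theorems.DepletionLadder.KStar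
open Summit.NavierStokesRegularity.NavierStokesRegularity.Theorems.DepletionLadder.KStar.HalfSpace
open Summit.NavierStokesRegularity.NavierStokesRegularity.Theorems.DepletionLadder.KStar.BangBang
open Summit.NavierStokesRegularity.NavierStokesRegularity.Theorems.NearExtremalTransiencePerFlow.ZoneTransversality (PFC IsViolator)
open Summit.NavierStokesRegularity.NavierStokesRegularity.Theorems.NearExtremalTransiencePerFlow.SparseBangBang (IsSparse SparseEfficientTimes)

namespace Summit.NavierStokesRegularity.NavierStokesRegularity.Theorems.NearExtremalTransiencePerFlow.AnalyticGap

-- the problem directory repeats the summit name (`NavierStokesRegularity/NavierStokesRegularity`)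
set_option linter.dupNamespace false

/-- QUANTITATIVE ANALYTICITY AT THE DISSIPATION SCALE with radius parameter `ρ`: `‖Dʲv‖_∞ ≤ (j!·ρ^{-j})·M·λ^{-j}` for every
`j` — the Cauchy-estimate form of "real-analytic with radius `ρ·λ(v)` and complex-strip bound `∼ M`".  Written in the shape
of `BangBang.IsReg` so that `IsAnalyticReg ρ v M` IS `IsReg (fun j ↦ j!·ρ^{-j}) v M` definitionally.  (With `ContDiff ℝ ⊤ v`,
part of `IsAdm`, the `iteratedFDeriv` are the true derivatives; without it the predicate would be junk-vacuous.) -/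
def IsAnalyticReg (ρ : ℝ) (v : E3 → E3) (M : ℝ) : Prop :=
  ∀ (j : ℕ) (x : E3), ‖iteratedFDeriv ℝ j v x‖ ≤ ((j.factorial : ℝ) * ρ⁻¹ ^ j) * M * (lam v)⁻¹ ^ j

/-- The regularity budget of a `ρ`-analytic-regular field (verbatim). -/
def facBudget (ρ : ℝ) : ℕ → ℝ := fun j => (j.factorial : ℝ) * ρ⁻¹ ^ j

/-- `IsAnalyticReg ρ` IS `IsReg (facBudget ρ)` (verbatim one-liner of the line). [folklore] -/
theorem isReg_of_isAnalyticReg {ρ : ℝ} {v : E3 → E3} {M : ℝ} (h : IsAnalyticReg ρ v M) :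
    IsReg (facBudget ρ) v M := fun j x => h j x

/-- The factorial budget is `≥ 1` termwise for `0 < ρ ≤ 1` (verbatim lemma of the line). [folklore] -/
theorem one_le_facBudget {ρ : ℝ} (hρ : 0 < ρ) (hρ1 : ρ ≤ 1) (j : ℕ) : 1 ≤ facBudget ρ j := by
  have h1 : (1 : ℝ) ≤ (j.factorial : ℝ) := by exact_mod_cast Nat.succ_le_of_lt (Nat.factorial_pos j)
  have h2 : (1 : ℝ) ≤ ρ⁻¹ ^ j := one_le_pow₀ ((one_le_inv₀ hρ).2 hρ1)
  simpa [facBudget] using one_le_mul_of_one_le_of_one_le h1 h2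

/-- (P-F, LITERATURE FACT — to be typed as ONE Literature decl and cited, not proved here; rev 3) PROPAGATION OF
SMALLNESS FOR REAL-ANALYTIC FUNCTIONS FROM MEASURABLE SETS, in `E3`, operator-norm form: Vessella, Forum Math. 11 (1999)
695–703; Apraiz–Escauriaza–Wang–Zhang, JEMS 16 (2014) Thm 4 [arXiv:1202.4876 p5]: for `0 < ρ ≤ 1` and a volume fraction
`0 < s ≤ 1` there are `N > 0`, `θ ∈ (0,1]` such that every smooth `f` on `B(x₀,2R)` with `‖Dʲf‖ ≤ M·j!/(ρR)ʲ` there (hence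
real-analytic) and every measurable `E ⊆ B(x₀,R)` with `|E| ≥ s|B(x₀,R)|` satisfy `sup_{B(x₀,R)} |f| ≤ N (⨍_E |f|)^θ M^{1−θ}`.
(Operator-norm bounds on `iteratedFDeriv` imply the paper's partial-derivative bounds with the same `M, ρ`; constants monotone
in the fraction, whence the `≥ s` form.) -/
def AnalyticPropagationOfSmallness : Prop :=
  ∀ ρ s : ℝ, 0 < ρ → ρ ≤ 1 → 0 < s → s ≤ 1 →
    ∃ Nc θ : ℝ, 0 < Nc ∧ 0 < θ ∧ θ ≤ 1 ∧
      ∀ (f : E3 → ℝ) (x₀ : E3) (R M : ℝ), 0 < R → 0 < M → ContDiff ℝ (⊤ : ℕ∞) f →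
        (∀ (j : ℕ) (x : E3), x ∈ Metric.ball x₀ (2 * R) →
            ‖iteratedFDeriv ℝ j f x‖ ≤ M * (j.factorial : ℝ) / (ρ * R) ^ j) →
        ∀ E : Set E3, MeasurableSet E → E ⊆ Metric.ball x₀ R →
          s * (volume (Metric.ball x₀ R)).toReal ≤ (volume E).toReal →
          ∀ x ∈ Metric.ball x₀ R,
            |f x| ≤ Nc * ((∫ y in E, |f y|) / (volume E).toReal) ^ θ * M ^ (1 - θ)

/-- (P-R, Literature-grade) ANALYTIC PLATEAU SPREAD — the Remez-type inequality for analytic functions applied to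
`g = M² − |v|²`: for `ρ, r, c₀, R, η > 0` there is `δ > 0` such that a smooth field bounded by `M > 0`, `ρ`-analytic-regular,
whose `δ`-near-top set fills a `c₀`-fraction of `B(x₀, rλ)`, satisfies `‖v‖ ≥ (1−η)M` on ALL of `B(x₀, Rλ)`.
IN PRINT in Hölder form with exactly the `IsAnalyticReg` hypothesis (rev 2, idea-crit-4 g6 N1): Apraiz–Escauriaza–Wang–Zhang,
JEMS 16 (2014) Thm 4 [arXiv:1202.4876 p5], first proved by Vessella, Forum Math. 11 (1999) 695–703 — «`f` real-analytic in `B_{2R}`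
with `|∂^α f| ≤ M|α|!(ρR)^{-|α|}`, `0 < ρ ≤ 1`, `E ⊂ B_R` of positive measure ⇒ `‖f‖_{L^∞(B_R)} ≤ N (⨍_E |f|)^θ M^{1-θ}`,
`N, θ` depending only on `(ρ, |E|/|B_R|)`». Two applications to `g = M² − |v|²` (Leibniz: `|∂^α g| ≤ 3M²·|α|!·(ρλ/2)^{-|α|}`):
on `B(x₀, rλ)` from the near-top set (`⨍_E g ≤ 2δM²`), then on `B(x₀, Rλ)` from `E = B(x₀, rλ)`; both constants fixed
before `δ`. (Earlier route via Brudnyi's Remez-type inequality with the Bernstein index is not needed.)) -/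
def AnalyticPlateauSpread : Prop :=
  ∀ ρ r c₀ R η : ℝ, 0 < ρ → 0 < r → 0 < c₀ → 0 < R → 0 < η → ∃ δ : ℝ, 0 < δ ∧
    ∀ (v : E3 → E3) (M : ℝ) (x₀ : E3), 0 < M → ContDiff ℝ (⊤ : ℕ∞) v → (∀ x, ‖v x‖ ≤ M) →
      IsAnalyticReg ρ v M → 0 < lam v →
      ENNReal.ofReal (c₀ * (r * lam v) ^ 3) ≤ volume {x : E3 | x ∈ Metric.ball x₀ (r * lam v) ∧ (1 - δ) * M ≤ ‖v x‖} →
        ∀ x ∈ Metric.ball x₀ (R * lam v), (1 - η) * M ≤ ‖v x‖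

/-- (P-C, M) PLATEAU SOBOLEV COST — `L²` fields cannot afford large half-plateaus cheaply: there is an absolute `c > 0` with
`c·R·λ·M² ≤ Z` whenever an admissible field has `‖v‖ ≥ M/2` on a ball `B(x₀, R·λ)`.  (GNS `‖w‖₆ ≤ C_S‖∇w‖₂` for a smooth
truncation `w = f(|v|²/M²)`, `w = 1` on the ball, `|∇w| ≤ 11|∇v|/M`, `∫|∇v|² = Z` for divergence-free `H¹` fields, and
`w ∈ L²` from `v ∈ L²` for the compact-support approximation.) -/
def PlateauSobolevCost : Prop :=
  ∃ c : ℝ, 0 < c ∧ ∀ (v : E3 → E3) (M B R : ℝ) (x₀ : E3), IsAdm v M B → 0 < M → 0 < R → 0 < lam v →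
    (∀ x ∈ Metric.ball x₀ (R * lam v), M / 2 ≤ ‖v x‖) → c * (R * lam v) * M ^ 2 ≤ Zen v

/-- (G — PROVED below from S-B, P-R, P-C) SPARSE ANALYTIC GAP, the uniform form of `DepletionLadder.slice_lt_sharp` on the
sparse class: for `ρ ∈ (0,1]` and `N₀ > 0` there is `ε > 0` with `|J| ≤ (κ⋆ − ε)·M·√Z·√W` for every admissible,
`ρ`-analytic-regular, `N₀`-sparse, non-degenerate field. -/
def SparseAnalyticGap : Prop :=
  ∀ ρ : ℝ, 0 < ρ → ρ ≤ 1 → ∀ N₀ : ℝ, 0 < N₀ → ∃ ε : ℝ, 0 < ε ∧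
    ∀ (v : E3 → E3) (M B : ℝ), IsAdm v M B → IsAnalyticReg ρ v M → IsSparse N₀ v M →
      0 < M * Real.sqrt (Zen v) * Real.sqrt (Wpa v) →
        |Jst v| ≤ (kStar - ε) * M * Real.sqrt (Zen v) * Real.sqrt (Wpa v)

/-- (S-A, provable-grade) SPARSE ANALYTIC TRANSFER — the flow side: given S-E, a violator flow has flow-uniform `ρ ∈ (0,1]`,
`N₀ > 0` such that for every `ε > 0` some slice `u(t)`, `t ∈ [0,T)`, with some bounds `M, B`, is admissible,
`ρ`-analytic-regular, `N₀`-sparse, non-degenerate and `(κ⋆−ε)`-efficient.  (From S-E's sparse two-sided-locked near-efficient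
late time: `IsAdm` by classical smoothness + slice Sobolev finiteness; analyticity radius `≥ c·√(ν(T−t))/C'` with strip bound
`≤ 2C√ν/√(T−t')` by Grujić–Kukavica 1998 (Thm 2.1/3.6) restarted at `t' = t − (T−t)/C'²`, converted to `λ(u t)` by the upper
lock and to the height `M ≥ ‖u(t)‖_∞ ≥ c₀√ν/√(T−t)` by `PerFlow.lerayLowerRate_of_not_extends`; sparseness in `λ(u t)` units by
the lower lock.) -/
def SparseAnalyticTransfer : Prop :=
  SparseEfficientTimes → ∀ (C ν T : ℝ) (u : ℝ → E3 → E3) (p : ℝ → E3 → ℝ), IsViolator C ν T u p →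
    ∃ ρ N₀ : ℝ, 0 < ρ ∧ ρ ≤ 1 ∧ 0 < N₀ ∧ ∀ ε : ℝ, 0 < ε → ∃ (t M B : ℝ), t ∈ Set.Ico 0 T ∧
      IsAdm (u t) M B ∧ IsAnalyticReg ρ (u t) M ∧ IsSparse N₀ (u t) M ∧
      0 < M * Real.sqrt (Zen (u t)) * Real.sqrt (Wpa (u t)) ∧
      (kStar - ε) * M * Real.sqrt (Zen (u t)) * Real.sqrt (Wpa (u t)) ≤ |Jst (u t)|

end Summit.NavierStokesRegularity.NavierStokesRegularity.Theorems.NearExtremalTransiencePerFlow.AnalyticGap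

end
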